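import Literature.NumberTheory.Automorphic.Liu2021.SplitPlaceHeckeEigenvaluesGlobal
import Literature.NumberTheory.Automorphic.Liu2021.SplitPlaceHeckeEigenvaluesAtLine
import Literature.NumberTheory.Automorphic.Liu2021.CheckOfChiLocal
import Literature.NumberTheory.Automorphic.Liu2021.Def411IrreducibleOfLemD1AsPrinted
import Literature.NumberTheory.Automorphic.Liu2021.Def411WeilCarriersChiUnitary
import Literature.NumberTheory.Automorphic.UnitaryGroupHyperspecialHecke
import Literature.NumberTheory.Automorphic.AdicCompletionUniformizerResidueCardGlue
import Literature.NumberTheory.GelbartRogawski1991.LocalSplittingCMGaloisTransport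
import Literature.RepresentationTheory.Liu2021.OscillatorConventions
import HarnessLib

/-!
# [Liu2021, Lem. D.1 (2)] at a split place — THE JUNCTION: the CM θ-package's local eigen-equations in the `hloc` form of the global assembly

Topic `Literature/NumberTheory/Automorphic/Liu2021`; proof file (theorems only: no definition, no named fact, no instance, no `sorry`);
count-neutral.  Written for the d6 line of cell `hodgecm-mathlib` (card S4); HC_CM is NOT proved by anything here.

For ANY unitary splitting character `θ` of the CM field `L`, the split-place eigen-equations of the local Weil representation at THE CM
`θ`-package (★ `splitPlace_heckeOperator_localInt_apply_localSplittingCM_comp_localLineInl`, `ν = θ_w`: `T₁ ↦ √q_w(θ_w(ϖ_w) +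
χ̌_w(ϖ_w)θ_w(ϖ_w)⁻¹)`, `T₂ ↦ χ̌_w(ϖ_w)`, read through `localLineInl`; `hs := congrW_undoubledSplittings_cmFinLocalFamily_s`,
`hT₀t := gram_realDiagonal_TW`, `χ′ := χ̌_w` by `forall_localComponent_checkOfChi_det`, `hϖ := isUniformizingElement_heckeCharacterUniformizer`)
ARE, token for token, the hypothesis `hloc` of the global assembly ★ `Def411WeilCarriers.rhoVAtLine_congr_heckeTAt_apply_eq_smul`
at `(𝔪, 𝓕) := (borelPlaceMeasure, cmFinLocalFamily … θ …)`, `ϖ := ϖ_w`, `i = 1, 2` (`cm_hloc_one`, `cm_hloc_two`).  §1 collects the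
small frame facts (`c² = 1`; the real diagonal frame `diag dJ` and its doubling `reindex (diag dJ ⊗ J_W(a))` are hermitian and
invertible) and the transport of an eigen-equation along `Units.mk0 ↑ϖ_w _ = ϖ_w`.  Consumer: `LemD1SplitPlaceHeckeEigenvaluesChain`.

## References
* [Liu2021] Y. Liu, *Fourier–Jacobi cycles and arithmetic relative trace formula*, Camb. J. Math. 9 (2021) = arXiv:2102.11518: App. D §D.1
  (l. 5224), Lemma D.1 (2) and its proof, first paragraph (l. 5241, p. 126).
* [GelbartRogawski1991] S. Gelbart, J. Rogawski, Invent. Math. 105 (1991), §3.1 p. 454, §3.2 p. 457.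
* [CartierCorvallis1979] P. Cartier, *Representations of p-adic groups: a survey*, PSPM 33 part 1 (1979), §IV.1.
-/

set_option autoImplicit false

noncomputable section


open scoped Matrix Kronecker TensorProduct Classical RestrictedProduct MatrixGroups NumberField
open NumberField NumberField.InfinitePlace IsDedekindDomain Filter Set MulAction
open Literature.NumberTheory Literature.NumberTheory.Automorphic Literature.NumberTheory.Automorphic.UnitaryGroup
open Literature.NumberTheory.GelbartRogawski1991 Literature.NumberTheory.GelbartRogawski1991.UnitaryDualPair
open Literature.NumberTheory.GelbartRogawski1991.UnitaryDualPair.WeilCoinv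
open Literature.NumberTheory.GelbartRogawski1991.GRConstruction
open Literature.NumberTheory.Weil1964 Literature.RepresentationTheory
open Literature.RepresentationTheory.HeisenbergGroup
open Literature.NumberTheory.GaloisRepresentations Literature.RepresentationTheory.HarrisKudlaSweet1996
open Literature.NumberTheory.Automorphic.Liu2021.Def411WeilCarriersDoubling

namespace Literature.NumberTheory.Automorphic.Liu2021.Def411WeilCarriers

open Literature.NumberTheory.Automorphic.IdeleClassGroup Literature.RepresentationTheory.Liu2021
open Literature.NumberTheory.GelbartRogawski1991.UnitaryDualPair.LocalSplitting

/-! ## §1 Small facts: `c² = 1`; the real diagonal frame and its doubling by the line `⟨a⟩` -/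

/-- `c² = 1` for the complex conjugation of a CM field — the `hcc` under which [Liu2021, App. D §D.1 (l. 5224)] defines
`χ̌(x) = χ(x/xᶜ)` (★ `HeckeCharacter.checkOfChi`). [cite: Liu2021, App. D §D.1 (l. 5224)] -/
theorem complexConj_mul_complexConj' (K : Type) [Field K] [NumberField K] [IsCMField K] :
    IsCMField.complexConj K * IsCMField.complexConj K = 1 :=
  AlgEquiv.ext fun x => by
    rw [AlgEquiv.mul_apply, IsCMField.complexConj_apply_apply, AlgEquiv.one_apply]


/-- a real diagonal form is hermitian: `ᵗ(c · diag dJ) = diag dJ`. [cite: GelbartRogawski1991, §3.1 p. 454] -/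
theorem conjTranspose_realDiagonal (L : Type) [Field L] [NumberField L] [IsCMField L]
    (dJ : Fin 2 → L) (hdJ : ∀ i, IsCMField.complexConj L (dJ i) = dJ i) :
    ((Matrix.diagonal dJ).map (IsCMField.complexConj L))ᵀ = Matrix.diagonal dJ := by
  rw [← realDiagonal_map L dJ hdJ]
  ext i j
  simp only [Matrix.transpose_apply, Matrix.map_apply, AlgEquiv.commutes]
  rw [(realDiagonal_isSymm L dJ hdJ).apply i j]

/-- a diagonal form with non-zero entries is invertible. [cite: GelbartRogawski1991, §3.1 p. 454] -/
theorem isUnit_realDiagonal (L : Type) [Field L] (dJ : Fin 2 → L) (hdJ0 : ∀ i, dJ i ≠ 0) :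
    IsUnit (Matrix.diagonal dJ) := by
  rw [Matrix.isUnit_iff_isUnit_det, Matrix.det_diagonal]
  exact IsUnit.mk0 _ (Finset.prod_ne_zero_iff.2 fun i _ => hdJ0 i)

/-- the doubled form `reindex (diag dJ ⊗ J_W(a))` is the base change of the (real, symmetric, diagonal) Gram matrix. [cite: GelbartRogawski1991, §3.1 p. 454] -/
theorem diagonalKroneckerLine_eq_map (L : Type) [Field L] [NumberField L] [IsCMField L]
    (dJ : Fin 2 → L) (hdJ : ∀ i, IsCMField.complexConj L (dJ i) = dJ i) (a : (↥(maximalRealSubfield L))ˣ) :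
    Matrix.reindex (finProdFinEquiv : Fin 2 × Fin 1 ≃ Fin (2 * 1)) finProdFinEquiv
        (Matrix.diagonal dJ ⊗ₖ JW ↥(maximalRealSubfield L) L a) =
      (gram ↥(maximalRealSubfield L) (finProdFinEquiv : Fin 2 × Fin 1 ≃ Fin (2 * 1)) (realDiagonal L dJ hdJ)
        (TW ↥(maximalRealSubfield L) a)).map (algebraMap ↥(maximalRealSubfield L) L) :=
  reindex_kronecker_eq_gram_map ↥(maximalRealSubfield L) L finProdFinEquiv (realDiagonal_map L dJ hdJ).symm
    (JW_eq ↥(maximalRealSubfield L) L a)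

/-- the doubled form is hermitian. [cite: GelbartRogawski1991, §3.1 p. 454] -/
theorem conjTranspose_diagonalKroneckerLine (L : Type) [Field L] [NumberField L] [IsCMField L]
    (dJ : Fin 2 → L) (hdJ : ∀ i, IsCMField.complexConj L (dJ i) = dJ i) (a : (↥(maximalRealSubfield L))ˣ) :
    ((Matrix.reindex (finProdFinEquiv : Fin 2 × Fin 1 ≃ Fin (2 * 1)) finProdFinEquiv
        (Matrix.diagonal dJ ⊗ₖ JW ↥(maximalRealSubfield L) L a)).map (IsCMField.complexConj L))ᵀ =
      Matrix.reindex (finProdFinEquiv : Fin 2 × Fin 1 ≃ Fin (2 * 1)) finProdFinEquiv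
        (Matrix.diagonal dJ ⊗ₖ JW ↥(maximalRealSubfield L) L a) := by
  rw [diagonalKroneckerLine_eq_map L dJ hdJ a]
  ext i j
  simp only [Matrix.transpose_apply, Matrix.map_apply, AlgEquiv.commutes]
  rw [(isSymm_gram ↥(maximalRealSubfield L) finProdFinEquiv (realDiagonal_isSymm L dJ hdJ)
    (isSymm_TW ↥(maximalRealSubfield L) a)).apply i j]

/-- the doubled form is invertible. [cite: GelbartRogawski1991, §3.1 p. 454] -/
theorem isUnit_diagonalKroneckerLine (L : Type) [Field L] [NumberField L] [IsCMField L]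
    (dJ : Fin 2 → L) (hdJ : ∀ i, IsCMField.complexConj L (dJ i) = dJ i) (hdJ0 : ∀ i, dJ i ≠ 0)
    (a : (↥(maximalRealSubfield L))ˣ) :
    IsUnit (Matrix.reindex (finProdFinEquiv : Fin 2 × Fin 1 ≃ Fin (2 * 1)) finProdFinEquiv
        (Matrix.diagonal dJ ⊗ₖ JW ↥(maximalRealSubfield L) L a)) := by
  rw [Matrix.isUnit_iff_isUnit_det, diagonalKroneckerLine_eq_map L dJ hdJ a, ← RingHom.mapMatrix_apply, ← RingHom.map_det]
  exact (isUnit_det_gram ↥(maximalRealSubfield L) finProdFinEquiv (isUnit_det_realDiagonal L dJ hdJ hdJ0)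
    (isUnit_det_TW ↥(maximalRealSubfield L) a)).map _


/-- transport of a split-place Hecke eigen-equation along an equality of uniformisers (bookkeeping for `Units.mk0 ↑ϖ_w _ = ϖ_w`:
the implicit data of `heckeTAt` are read off `h`, so no instance is re-synthesised). [cite: CartierCorvallis1979, §IV.1] -/
theorem heckeTAt_apply_eq_of_eq {F E : Type} [Field F] [NumberField F] [Field E] [NumberField E] [Algebra F E]
    [Algebra.IsQuadraticExtension F E] {c : E ≃ₐ[F] E} {N : ℕ} {J : Matrix (Fin N) (Fin N) E}
    {k V : Type*} [CommRing k] [AddCommGroup V] [Module k V] {ρ : Representation k (finAdelic F E c N J) V}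
    {K : Subgroup (finAdelic F E c N J)} {v : HeightOneSpectrum (𝓞 F)} {w : UnitaryGroup.PlacesOver E v} {hc : c ≠ 1}
    {hJ : (J.map c)ᵀ = J} {hw : c • w.1 ≠ w.1} {hJw : IsUnit (placeForm J w.1)} {ϖ ϖ' : (w.1.adicCompletion E)ˣ}
    (e : ϖ = ϖ') {i : ℕ} {x y : V} (h : UnitaryGroup.heckeTAt F E c N J ρ K w hc hJ hw hJw ϖ i x = y) :
    UnitaryGroup.heckeTAt F E c N J ρ K w hc hJ hw hJw ϖ' i x = y := e ▸ h

/-! ## §2 The junction: S4c-L's local eigen-equations ARE S4c-G's `hloc` at the CM package -/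

set_option maxHeartbeats 2000000 in -- measured BY IMPORT 1.49 M: ONE definitional re-spelling of the θ-package tower (S4c-L's `((toRep).comp s).comp localCenter` ≡ S4c-G's `omegaLoc v` form)
/-- **Junction, `T₁`**: at THE CM `θ`-package, S4c-L's local eigen-equation (★ p748968) IS the `hloc` hypothesis of S4c-G
(★ p752633) at `ϖ := ϖ_w`, `i = 1`, spelt in S4c-G's own carrier form. [cite: Liu2021, App. D proof of Lemma D.1, first paragraph (l. 5241, p. 126)] [cite: GelbartRogawski1991, §3.2 p. 457] -/
theorem cm_hloc_one (L : Type) [Field L] [NumberField L] [IsCMField L]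
    (θ : HeckeCharacter L) (hθu : θ.IsUnitary) (hθs : IsSplittingChar L 1 θ)
    (dJ : Fin 2 → L) (hdJ : ∀ i, IsCMField.complexConj L (dJ i) = dJ i) (hdJ0 : ∀ i, dJ i ≠ 0)
    (r : Rep ↥(maximalRealSubfield L) (imagUnitSq L)) (ε : Eps ↥(maximalRealSubfield L) (imagUnitSq L))
    (χ : Chi ↥(maximalRealSubfield L) L (IsCMField.complexConj L))
    {v : HeightOneSpectrum (𝓞 (Fp L))} (w : UnitaryGroup.PlacesOver L v) (hw : IsCMField.complexConj L • w.1 ≠ w.1)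
    (hJDi : (isUnit_placeForm _ (isUnit_diagonalKroneckerLine L dJ hdJ hdJ0 (r.toFun ε)) w.1).unit ∈ glInt 2 (w.1.adicCompletion L)) :
    ∀ y ∈ Representation.fixedPoints
            (show Representation ℂ (localPi L (IsCMField.complexConj L) 2 (Matrix.diagonal dJ) v) _ from
          (TwistedCoinv.rep (localCharOfCenter (Fp L) L (IsCMField.complexConj L) (JW (Fp L) L (r.toFun ε))
            (JW_apply_ne_zero (Fp L) L (r.toFun ε)) χ.1 v) ((congrW L (finProdFinEquiv : Fin 2 × Fin 1 ≃ Fin (2 * 1)) dJ hdJ (lineW L (TW (Fp L) (r.toFun ε))) (complexConj_lineW L (TW (Fp L) (r.toFun ε))) (realDiagonal_lineW L (TW (Fp L) (r.toFun ε)))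
              (diagonal_lineW L (TW (Fp L) (r.toFun ε)) (JW_eq (Fp L) L (r.toFun ε)))
              (undoubledSplittings L (finProdFinEquiv : Fin 2 × Fin 1 ≃ Fin (2 * 1)) dJ hdJ hdJ0 (lineW L (TW (Fp L) (r.toFun ε))) (complexConj_lineW L (TW (Fp L) (r.toFun ε)))
                (lineW_ne_zero L (TW (Fp L) (r.toFun ε)) (isUnit_det_TW (Fp L) (r.toFun ε))) θ (borelPlaceMeasure L) (cmFinLocalFamily L (finProdFinEquiv : Fin 2 × Fin 1 ≃ Fin (2 * 1)) dJ hdJ hdJ0 (lineW L (TW (Fp L) (r.toFun ε))) (complexConj_lineW L (TW (Fp L) (r.toFun ε))) (lineW_ne_zero L (TW (Fp L) (r.toFun ε)) (isUnit_det_TW (Fp L) (r.toFun ε))) θ hθs (borelPlaceMeasure L)))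
              (isSymm_TW (Fp L) (r.toFun ε)) (JW_eq (Fp L) L (r.toFun ε))).omegaLoc v)
          (commute_omegaLoc_localCenter (Fp L) L (IsCMField.complexConj L) 2 (finProdFinEquiv : Fin 2 × Fin 1 ≃ Fin (2 * 1)) (Matrix.diagonal dJ) (JW (Fp L) L (r.toFun ε))
            (complexConj_imagUnit L) (imagUnit_ne_zero L) (imagUnit_mul_self L) (realDiagonal_isSymm L dJ hdJ)
            (isSymm_TW (Fp L) (r.toFun ε)) (realDiagonal_map L dJ hdJ).symm (JW_eq (Fp L) L (r.toFun ε)) (JW_apply_ne_zero (Fp L) L (r.toFun ε)) (congrW L (finProdFinEquiv : Fin 2 × Fin 1 ≃ Fin (2 * 1)) dJ hdJ (lineW L (TW (Fp L) (r.toFun ε))) (complexConj_lineW L (TW (Fp L) (r.toFun ε))) (realDiagonal_lineW L (TW (Fp L) (r.toFun ε)))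
              (diagonal_lineW L (TW (Fp L) (r.toFun ε)) (JW_eq (Fp L) L (r.toFun ε)))
              (undoubledSplittings L (finProdFinEquiv : Fin 2 × Fin 1 ≃ Fin (2 * 1)) dJ hdJ hdJ0 (lineW L (TW (Fp L) (r.toFun ε))) (complexConj_lineW L (TW (Fp L) (r.toFun ε)))
                (lineW_ne_zero L (TW (Fp L) (r.toFun ε)) (isUnit_det_TW (Fp L) (r.toFun ε))) θ (borelPlaceMeasure L) (cmFinLocalFamily L (finProdFinEquiv : Fin 2 × Fin 1 ≃ Fin (2 * 1)) dJ hdJ hdJ0 (lineW L (TW (Fp L) (r.toFun ε))) (complexConj_lineW L (TW (Fp L) (r.toFun ε))) (lineW_ne_zero L (TW (Fp L) (r.toFun ε)) (isUnit_det_TW (Fp L) (r.toFun ε))) θ hθs (borelPlaceMeasure L)))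
              (isSymm_TW (Fp L) (r.toFun ε)) (JW_eq (Fp L) L (r.toFun ε))) v)).comp
            (localLineInl L (IsCMField.complexConj L) 2 (finProdFinEquiv : Fin 2 × Fin 1 ≃ Fin (2 * 1)) (Matrix.diagonal dJ) (JW (Fp L) L (r.toFun ε)) v))
            (localInt L (IsCMField.complexConj L) 2 (Matrix.diagonal dJ) v),
          heckeOperator
            (show Representation ℂ (localPi L (IsCMField.complexConj L) 2 (Matrix.diagonal dJ) v) _ from
          (TwistedCoinv.rep (localCharOfCenter (Fp L) L (IsCMField.complexConj L) (JW (Fp L) L (r.toFun ε))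
            (JW_apply_ne_zero (Fp L) L (r.toFun ε)) χ.1 v) ((congrW L (finProdFinEquiv : Fin 2 × Fin 1 ≃ Fin (2 * 1)) dJ hdJ (lineW L (TW (Fp L) (r.toFun ε))) (complexConj_lineW L (TW (Fp L) (r.toFun ε))) (realDiagonal_lineW L (TW (Fp L) (r.toFun ε)))
              (diagonal_lineW L (TW (Fp L) (r.toFun ε)) (JW_eq (Fp L) L (r.toFun ε)))
              (undoubledSplittings L (finProdFinEquiv : Fin 2 × Fin 1 ≃ Fin (2 * 1)) dJ hdJ hdJ0 (lineW L (TW (Fp L) (r.toFun ε))) (complexConj_lineW L (TW (Fp L) (r.toFun ε)))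
                (lineW_ne_zero L (TW (Fp L) (r.toFun ε)) (isUnit_det_TW (Fp L) (r.toFun ε))) θ (borelPlaceMeasure L) (cmFinLocalFamily L (finProdFinEquiv : Fin 2 × Fin 1 ≃ Fin (2 * 1)) dJ hdJ hdJ0 (lineW L (TW (Fp L) (r.toFun ε))) (complexConj_lineW L (TW (Fp L) (r.toFun ε))) (lineW_ne_zero L (TW (Fp L) (r.toFun ε)) (isUnit_det_TW (Fp L) (r.toFun ε))) θ hθs (borelPlaceMeasure L)))
              (isSymm_TW (Fp L) (r.toFun ε)) (JW_eq (Fp L) L (r.toFun ε))).omegaLoc v)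
          (commute_omegaLoc_localCenter (Fp L) L (IsCMField.complexConj L) 2 (finProdFinEquiv : Fin 2 × Fin 1 ≃ Fin (2 * 1)) (Matrix.diagonal dJ) (JW (Fp L) L (r.toFun ε))
            (complexConj_imagUnit L) (imagUnit_ne_zero L) (imagUnit_mul_self L) (realDiagonal_isSymm L dJ hdJ)
            (isSymm_TW (Fp L) (r.toFun ε)) (realDiagonal_map L dJ hdJ).symm (JW_eq (Fp L) L (r.toFun ε)) (JW_apply_ne_zero (Fp L) L (r.toFun ε)) (congrW L (finProdFinEquiv : Fin 2 × Fin 1 ≃ Fin (2 * 1)) dJ hdJ (lineW L (TW (Fp L) (r.toFun ε))) (complexConj_lineW L (TW (Fp L) (r.toFun ε))) (realDiagonal_lineW L (TW (Fp L) (r.toFun ε)))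
              (diagonal_lineW L (TW (Fp L) (r.toFun ε)) (JW_eq (Fp L) L (r.toFun ε)))
              (undoubledSplittings L (finProdFinEquiv : Fin 2 × Fin 1 ≃ Fin (2 * 1)) dJ hdJ hdJ0 (lineW L (TW (Fp L) (r.toFun ε))) (complexConj_lineW L (TW (Fp L) (r.toFun ε)))
                (lineW_ne_zero L (TW (Fp L) (r.toFun ε)) (isUnit_det_TW (Fp L) (r.toFun ε))) θ (borelPlaceMeasure L) (cmFinLocalFamily L (finProdFinEquiv : Fin 2 × Fin 1 ≃ Fin (2 * 1)) dJ hdJ hdJ0 (lineW L (TW (Fp L) (r.toFun ε))) (complexConj_lineW L (TW (Fp L) (r.toFun ε))) (lineW_ne_zero L (TW (Fp L) (r.toFun ε)) (isUnit_det_TW (Fp L) (r.toFun ε))) θ hθs (borelPlaceMeasure L)))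
              (isSymm_TW (Fp L) (r.toFun ε)) (JW_eq (Fp L) L (r.toFun ε))) v)).comp
            (localLineInl L (IsCMField.complexConj L) 2 (finProdFinEquiv : Fin 2 × Fin 1 ≃ Fin (2 * 1)) (Matrix.diagonal dJ) (JW (Fp L) L (r.toFun ε)) v))
            (localInt L (IsCMField.complexConj L) 2 (Matrix.diagonal dJ) v)
            ((localPiSplitEquiv (IsCMField.complexConj L) (Matrix.diagonal dJ) (IsCMField.complexConj_ne_one L) (conjTranspose_realDiagonal L dJ hdJ) w hw (isUnit_placeForm (Matrix.diagonal dJ) (isUnit_realDiagonal L dJ hdJ0) w.1)).symm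
              (heckeDiag 2 (Units.mk0 ((HeckeCharacter.uniformizer L w.1 : (w.1.adicCompletion L)ˣ) : w.1.adicCompletion L) (Units.ne_zero _)) 1)) y =
    (((Real.sqrt (GaloisRepresentations.IsNonarchimedeanLocalField.residueFieldCard (w.1.adicCompletion L))) : ℂ) *
      ((((θ.localComponent w.1) (Units.mk0 ((HeckeCharacter.uniformizer L w.1 : (w.1.adicCompletion L)ˣ) : w.1.adicCompletion L) (Units.ne_zero _)) : ℂˣ) : ℂ) +
        ((((HeckeCharacter.checkOfChi (complexConj_mul_complexConj' L) χ).localComponent w.1) (Units.mk0 ((HeckeCharacter.uniformizer L w.1 : (w.1.adicCompletion L)ˣ) : w.1.adicCompletion L) (Units.ne_zero _)) : ℂˣ) : ℂ) *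
          ((((θ.localComponent w.1) (Units.mk0 ((HeckeCharacter.uniformizer L w.1 : (w.1.adicCompletion L)ˣ) : w.1.adicCompletion L) (Units.ne_zero _)) : ℂˣ) : ℂ))⁻¹)) • y := fun _ hy =>
  (splitPlace_heckeOperator_localInt_apply_localSplittingCM_comp_localLineInl L (IsCMField.complexConj_ne_one L) (Matrix.diagonal dJ)
    (JW ↥(maximalRealSubfield L) L (r.toFun ε)) (JW_apply_ne_zero ↥(maximalRealSubfield L) L (r.toFun ε)) _ _ _ _
    (gram_realDiagonal_TW L finProdFinEquiv dJ hdJ (r.toFun ε)) _ (conjTranspose_realDiagonal L dJ hdJ)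
    (conjTranspose_diagonalKroneckerLine L dJ hdJ (r.toFun ε)) v w hw
    (isUnit_placeForm (Matrix.diagonal dJ) (isUnit_realDiagonal L dJ hdJ0) w.1)
    (isUnit_placeForm _ (isUnit_diagonalKroneckerLine L dJ hdJ hdJ0 (r.toFun ε)) w.1) hJDi θ hθs hθu _
    (GRConstruction.congrW_undoubledSplittings_cmFinLocalFamily_s L finProdFinEquiv dJ hdJ hdJ0
      (lineW L (TW ↥(maximalRealSubfield L) (r.toFun ε))) (complexConj_lineW L (TW ↥(maximalRealSubfield L) (r.toFun ε)))
      (lineW_ne_zero L (TW ↥(maximalRealSubfield L) (r.toFun ε)) (isUnit_det_TW ↥(maximalRealSubfield L) (r.toFun ε)))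
      (realDiagonal_lineW L (TW ↥(maximalRealSubfield L) (r.toFun ε)))
      (diagonal_lineW L (TW ↥(maximalRealSubfield L) (r.toFun ε)) (JW_eq ↥(maximalRealSubfield L) L (r.toFun ε)))
      (isSymm_TW ↥(maximalRealSubfield L) (r.toFun ε)) (isUnit_det_TW ↥(maximalRealSubfield L) (r.toFun ε))
      (JW_eq ↥(maximalRealSubfield L) L (r.toFun ε)) θ hθs v)
    (localCharOfCenter ↥(maximalRealSubfield L) L (IsCMField.complexConj L) (JW ↥(maximalRealSubfield L) L (r.toFun ε))
      (JW_apply_ne_zero ↥(maximalRealSubfield L) L (r.toFun ε)) χ.1 v)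
    (norm_localCharOfCenter ↥(maximalRealSubfield L) L (IsCMField.complexConj L) _ _ (norm_chi_eq_one_cm L χ) _)
    (continuous_coe_localCharOfCenter ↥(maximalRealSubfield L) L (IsCMField.complexConj L) _ _ χ.2.1 _)
    ((HeckeCharacter.checkOfChi (complexConj_mul_complexConj' L) χ).localComponent w.1)
    (CheckOfChi.forall_localComponent_checkOfChi_det (complexConj_mul_complexConj' L)
      (JW_apply_ne_zero ↥(maximalRealSubfield L) L (r.toFun ε)) χ w hw)
    (isUniformizingElement_heckeCharacterUniformizer L w.1) hy).1

set_option maxHeartbeats 2000000 in -- as `cm_hloc_one`; measured BY IMPORT 1.27 M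
/-- **Junction, `T₂`**: the same at `i = 2` (eigenvalue `χ̌_w(ϖ_w)`). [cite: Liu2021, App. D proof of Lemma D.1, first paragraph (l. 5241, p. 126)] [cite: GelbartRogawski1991, §3.2 p. 457] -/
theorem cm_hloc_two (L : Type) [Field L] [NumberField L] [IsCMField L]
    (θ : HeckeCharacter L) (hθu : θ.IsUnitary) (hθs : IsSplittingChar L 1 θ)
    (dJ : Fin 2 → L) (hdJ : ∀ i, IsCMField.complexConj L (dJ i) = dJ i) (hdJ0 : ∀ i, dJ i ≠ 0)
    (r : Rep ↥(maximalRealSubfield L) (imagUnitSq L)) (ε : Eps ↥(maximalRealSubfield L) (imagUnitSq L))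
    (χ : Chi ↥(maximalRealSubfield L) L (IsCMField.complexConj L))
    {v : HeightOneSpectrum (𝓞 (Fp L))} (w : UnitaryGroup.PlacesOver L v) (hw : IsCMField.complexConj L • w.1 ≠ w.1)
    (hJDi : (isUnit_placeForm _ (isUnit_diagonalKroneckerLine L dJ hdJ hdJ0 (r.toFun ε)) w.1).unit ∈ glInt 2 (w.1.adicCompletion L)) :
    ∀ y ∈ Representation.fixedPoints
            (show Representation ℂ (localPi L (IsCMField.complexConj L) 2 (Matrix.diagonal dJ) v) _ from
          (TwistedCoinv.rep (localCharOfCenter (Fp L) L (IsCMField.complexConj L) (JW (Fp L) L (r.toFun ε))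
            (JW_apply_ne_zero (Fp L) L (r.toFun ε)) χ.1 v) ((congrW L (finProdFinEquiv : Fin 2 × Fin 1 ≃ Fin (2 * 1)) dJ hdJ (lineW L (TW (Fp L) (r.toFun ε))) (complexConj_lineW L (TW (Fp L) (r.toFun ε))) (realDiagonal_lineW L (TW (Fp L) (r.toFun ε)))
              (diagonal_lineW L (TW (Fp L) (r.toFun ε)) (JW_eq (Fp L) L (r.toFun ε)))
              (undoubledSplittings L (finProdFinEquiv : Fin 2 × Fin 1 ≃ Fin (2 * 1)) dJ hdJ hdJ0 (lineW L (TW (Fp L) (r.toFun ε))) (complexConj_lineW L (TW (Fp L) (r.toFun ε)))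
                (lineW_ne_zero L (TW (Fp L) (r.toFun ε)) (isUnit_det_TW (Fp L) (r.toFun ε))) θ (borelPlaceMeasure L) (cmFinLocalFamily L (finProdFinEquiv : Fin 2 × Fin 1 ≃ Fin (2 * 1)) dJ hdJ hdJ0 (lineW L (TW (Fp L) (r.toFun ε))) (complexConj_lineW L (TW (Fp L) (r.toFun ε))) (lineW_ne_zero L (TW (Fp L) (r.toFun ε)) (isUnit_det_TW (Fp L) (r.toFun ε))) θ hθs (borelPlaceMeasure L)))
              (isSymm_TW (Fp L) (r.toFun ε)) (JW_eq (Fp L) L (r.toFun ε))).omegaLoc v)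
          (commute_omegaLoc_localCenter (Fp L) L (IsCMField.complexConj L) 2 (finProdFinEquiv : Fin 2 × Fin 1 ≃ Fin (2 * 1)) (Matrix.diagonal dJ) (JW (Fp L) L (r.toFun ε))
            (complexConj_imagUnit L) (imagUnit_ne_zero L) (imagUnit_mul_self L) (realDiagonal_isSymm L dJ hdJ)
            (isSymm_TW (Fp L) (r.toFun ε)) (realDiagonal_map L dJ hdJ).symm (JW_eq (Fp L) L (r.toFun ε)) (JW_apply_ne_zero (Fp L) L (r.toFun ε)) (congrW L (finProdFinEquiv : Fin 2 × Fin 1 ≃ Fin (2 * 1)) dJ hdJ (lineW L (TW (Fp L) (r.toFun ε))) (complexConj_lineW L (TW (Fp L) (r.toFun ε))) (realDiagonal_lineW L (TW (Fp L) (r.toFun ε)))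
              (diagonal_lineW L (TW (Fp L) (r.toFun ε)) (JW_eq (Fp L) L (r.toFun ε)))
              (undoubledSplittings L (finProdFinEquiv : Fin 2 × Fin 1 ≃ Fin (2 * 1)) dJ hdJ hdJ0 (lineW L (TW (Fp L) (r.toFun ε))) (complexConj_lineW L (TW (Fp L) (r.toFun ε)))
                (lineW_ne_zero L (TW (Fp L) (r.toFun ε)) (isUnit_det_TW (Fp L) (r.toFun ε))) θ (borelPlaceMeasure L) (cmFinLocalFamily L (finProdFinEquiv : Fin 2 × Fin 1 ≃ Fin (2 * 1)) dJ hdJ hdJ0 (lineW L (TW (Fp L) (r.toFun ε))) (complexConj_lineW L (TW (Fp L) (r.toFun ε))) (lineW_ne_zero L (TW (Fp L) (r.toFun ε)) (isUnit_det_TW (Fp L) (r.toFun ε))) θ hθs (borelPlaceMeasure L)))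
              (isSymm_TW (Fp L) (r.toFun ε)) (JW_eq (Fp L) L (r.toFun ε))) v)).comp
            (localLineInl L (IsCMField.complexConj L) 2 (finProdFinEquiv : Fin 2 × Fin 1 ≃ Fin (2 * 1)) (Matrix.diagonal dJ) (JW (Fp L) L (r.toFun ε)) v))
            (localInt L (IsCMField.complexConj L) 2 (Matrix.diagonal dJ) v),
          heckeOperator
            (show Representation ℂ (localPi L (IsCMField.complexConj L) 2 (Matrix.diagonal dJ) v) _ from
          (TwistedCoinv.rep (localCharOfCenter (Fp L) L (IsCMField.complexConj L) (JW (Fp L) L (r.toFun ε))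
            (JW_apply_ne_zero (Fp L) L (r.toFun ε)) χ.1 v) ((congrW L (finProdFinEquiv : Fin 2 × Fin 1 ≃ Fin (2 * 1)) dJ hdJ (lineW L (TW (Fp L) (r.toFun ε))) (complexConj_lineW L (TW (Fp L) (r.toFun ε))) (realDiagonal_lineW L (TW (Fp L) (r.toFun ε)))
              (diagonal_lineW L (TW (Fp L) (r.toFun ε)) (JW_eq (Fp L) L (r.toFun ε)))
              (undoubledSplittings L (finProdFinEquiv : Fin 2 × Fin 1 ≃ Fin (2 * 1)) dJ hdJ hdJ0 (lineW L (TW (Fp L) (r.toFun ε))) (complexConj_lineW L (TW (Fp L) (r.toFun ε)))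
                (lineW_ne_zero L (TW (Fp L) (r.toFun ε)) (isUnit_det_TW (Fp L) (r.toFun ε))) θ (borelPlaceMeasure L) (cmFinLocalFamily L (finProdFinEquiv : Fin 2 × Fin 1 ≃ Fin (2 * 1)) dJ hdJ hdJ0 (lineW L (TW (Fp L) (r.toFun ε))) (complexConj_lineW L (TW (Fp L) (r.toFun ε))) (lineW_ne_zero L (TW (Fp L) (r.toFun ε)) (isUnit_det_TW (Fp L) (r.toFun ε))) θ hθs (borelPlaceMeasure L)))
              (isSymm_TW (Fp L) (r.toFun ε)) (JW_eq (Fp L) L (r.toFun ε))).omegaLoc v)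
          (commute_omegaLoc_localCenter (Fp L) L (IsCMField.complexConj L) 2 (finProdFinEquiv : Fin 2 × Fin 1 ≃ Fin (2 * 1)) (Matrix.diagonal dJ) (JW (Fp L) L (r.toFun ε))
            (complexConj_imagUnit L) (imagUnit_ne_zero L) (imagUnit_mul_self L) (realDiagonal_isSymm L dJ hdJ)
            (isSymm_TW (Fp L) (r.toFun ε)) (realDiagonal_map L dJ hdJ).symm (JW_eq (Fp L) L (r.toFun ε)) (JW_apply_ne_zero (Fp L) L (r.toFun ε)) (congrW L (finProdFinEquiv : Fin 2 × Fin 1 ≃ Fin (2 * 1)) dJ hdJ (lineW L (TW (Fp L) (r.toFun ε))) (complexConj_lineW L (TW (Fp L) (r.toFun ε))) (realDiagonal_lineW L (TW (Fp L) (r.toFun ε)))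
              (diagonal_lineW L (TW (Fp L) (r.toFun ε)) (JW_eq (Fp L) L (r.toFun ε)))
              (undoubledSplittings L (finProdFinEquiv : Fin 2 × Fin 1 ≃ Fin (2 * 1)) dJ hdJ hdJ0 (lineW L (TW (Fp L) (r.toFun ε))) (complexConj_lineW L (TW (Fp L) (r.toFun ε)))
                (lineW_ne_zero L (TW (Fp L) (r.toFun ε)) (isUnit_det_TW (Fp L) (r.toFun ε))) θ (borelPlaceMeasure L) (cmFinLocalFamily L (finProdFinEquiv : Fin 2 × Fin 1 ≃ Fin (2 * 1)) dJ hdJ hdJ0 (lineW L (TW (Fp L) (r.toFun ε))) (complexConj_lineW L (TW (Fp L) (r.toFun ε))) (lineW_ne_zero L (TW (Fp L) (r.toFun ε)) (isUnit_det_TW (Fp L) (r.toFun ε))) θ hθs (borelPlaceMeasure L)))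
              (isSymm_TW (Fp L) (r.toFun ε)) (JW_eq (Fp L) L (r.toFun ε))) v)).comp
            (localLineInl L (IsCMField.complexConj L) 2 (finProdFinEquiv : Fin 2 × Fin 1 ≃ Fin (2 * 1)) (Matrix.diagonal dJ) (JW (Fp L) L (r.toFun ε)) v))
            (localInt L (IsCMField.complexConj L) 2 (Matrix.diagonal dJ) v)
            ((localPiSplitEquiv (IsCMField.complexConj L) (Matrix.diagonal dJ) (IsCMField.complexConj_ne_one L) (conjTranspose_realDiagonal L dJ hdJ) w hw (isUnit_placeForm (Matrix.diagonal dJ) (isUnit_realDiagonal L dJ hdJ0) w.1)).symm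
              (heckeDiag 2 (Units.mk0 ((HeckeCharacter.uniformizer L w.1 : (w.1.adicCompletion L)ˣ) : w.1.adicCompletion L) (Units.ne_zero _)) 2)) y = ((((HeckeCharacter.checkOfChi (complexConj_mul_complexConj' L) χ).localComponent w.1) (Units.mk0 ((HeckeCharacter.uniformizer L w.1 : (w.1.adicCompletion L)ˣ) : w.1.adicCompletion L) (Units.ne_zero _)) : ℂˣ) : ℂ) • y := fun _ hy =>
  (splitPlace_heckeOperator_localInt_apply_localSplittingCM_comp_localLineInl L (IsCMField.complexConj_ne_one L) (Matrix.diagonal dJ)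
    (JW ↥(maximalRealSubfield L) L (r.toFun ε)) (JW_apply_ne_zero ↥(maximalRealSubfield L) L (r.toFun ε)) _ _ _ _
    (gram_realDiagonal_TW L finProdFinEquiv dJ hdJ (r.toFun ε)) _ (conjTranspose_realDiagonal L dJ hdJ)
    (conjTranspose_diagonalKroneckerLine L dJ hdJ (r.toFun ε)) v w hw
    (isUnit_placeForm (Matrix.diagonal dJ) (isUnit_realDiagonal L dJ hdJ0) w.1)
    (isUnit_placeForm _ (isUnit_diagonalKroneckerLine L dJ hdJ hdJ0 (r.toFun ε)) w.1) hJDi θ hθs hθu _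
    (GRConstruction.congrW_undoubledSplittings_cmFinLocalFamily_s L finProdFinEquiv dJ hdJ hdJ0
      (lineW L (TW ↥(maximalRealSubfield L) (r.toFun ε))) (complexConj_lineW L (TW ↥(maximalRealSubfield L) (r.toFun ε)))
      (lineW_ne_zero L (TW ↥(maximalRealSubfield L) (r.toFun ε)) (isUnit_det_TW ↥(maximalRealSubfield L) (r.toFun ε)))
      (realDiagonal_lineW L (TW ↥(maximalRealSubfield L) (r.toFun ε)))
      (diagonal_lineW L (TW ↥(maximalRealSubfield L) (r.toFun ε)) (JW_eq ↥(maximalRealSubfield L) L (r.toFun ε)))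
      (isSymm_TW ↥(maximalRealSubfield L) (r.toFun ε)) (isUnit_det_TW ↥(maximalRealSubfield L) (r.toFun ε))
      (JW_eq ↥(maximalRealSubfield L) L (r.toFun ε)) θ hθs v)
    (localCharOfCenter ↥(maximalRealSubfield L) L (IsCMField.complexConj L) (JW ↥(maximalRealSubfield L) L (r.toFun ε))
      (JW_apply_ne_zero ↥(maximalRealSubfield L) L (r.toFun ε)) χ.1 v)
    (norm_localCharOfCenter ↥(maximalRealSubfield L) L (IsCMField.complexConj L) _ _ (norm_chi_eq_one_cm L χ) _)
    (continuous_coe_localCharOfCenter ↥(maximalRealSubfield L) L (IsCMField.complexConj L) _ _ χ.2.1 _)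
    ((HeckeCharacter.checkOfChi (complexConj_mul_complexConj' L) χ).localComponent w.1)
    (CheckOfChi.forall_localComponent_checkOfChi_det (complexConj_mul_complexConj' L)
      (JW_apply_ne_zero ↥(maximalRealSubfield L) L (r.toFun ε)) χ w hw)
    (isUniformizingElement_heckeCharacterUniformizer L w.1) hy).2

end Literature.NumberTheory.Automorphic.Liu2021.Def411WeilCarriers

end
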